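import Mathlib
import Literature.NumberTheory.Automorphic.HilbertModularFormQExpansion

/-!
# The weight-`k` slash `f|_k g` of a holomorphic `f` is holomorphic on `ℍ`

Stub M-A6 (`stub_slash_holomorphic`) of line Sketch-ideate-r1-k1 for the crux
`HilbertIntegralOverconvergentIsCongruence` (stmt-Langlands-8485).  Section M of the line proves the
Koecher principle for Hilbert modular forms (Freitag, *Hilbert Modular Forms*, Ch. I Prop. 4.9
Cor.): for `[F:ℚ] ≥ 2` the cusp condition at every cusp `g ∈ SL₂(F)` is automatic; the composition
applies "holomorphic + periodic + unit-equivariant ⇒ bounded at `∞`" to `h = f|_k g = slash k g f`,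
and needs `h` holomorphic on `ℍ = halfSpace F` — this file.  Proof: the denominators
`σ(c) z_σ + σ(d)` and numerators `σ(a) z_σ + σ(b)` are `ℂ`-differentiable (affine in the coordinate
`z_σ` of the `Pi` space `ℂ^{Hom(F,ℝ)}`); the denominators do not vanish on `ℍ` (`denom_ne_zero`), so
`z ↦ g z` (`moeb g`) is differentiable on `ℍ` coordinatewise, and maps `ℍ` into itself since
`Im (g z)_σ = Im z_σ / |σ(c) z_σ + σ(d)|²` (`det g = 1`); hence `f ∘ moeb g` is differentiable on
`ℍ` (chain rule, `slh_differentiableOn_comp_moeb`), and so is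
`J_k(g, z)⁻¹ = (∏_σ (σ(c) z_σ + σ(d))^{k_σ})⁻¹` (finite product of integral powers of non-vanishing
differentiable functions, inverted where non-zero, `autFactor_ne_zero`).
-/

set_option linter.dupNamespace false

noncomputable section

namespace Summit.Langlands.Langlands.Theorems.HilbertIntegralOverconvergentIsCongruence

open MeasureTheory Complex NumberField
open Literature.NumberTheory.Automorphic Literature.NumberTheory.Automorphic.HilbertModular
open scoped MatrixGroups

variable {F : Type} [Field F] [NumberField F]

/-- The numerator `z ↦ σ(a) z_σ + σ(b)` of the action is `ℂ`-differentiable on `ℂ^{Hom(F,ℝ)}`. -/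
theorem slh_differentiable_num (g : SL(2, F)) (σ : F →+* ℝ) :
    Differentiable ℂ fun z : Point F ↦ (σ (g 0 0) : ℂ) * z σ + (σ (g 0 1) : ℂ) := by
  fun_prop

/-- The denominator `z ↦ σ(c) z_σ + σ(d)` of the action is `ℂ`-differentiable on `ℂ^{Hom(F,ℝ)}`. -/
theorem slh_differentiable_denom (g : SL(2, F)) (σ : F →+* ℝ) :
    Differentiable ℂ fun z : Point F ↦ denom g z σ := by
  unfold denom
  fun_prop

/-- The action `z ↦ g z` of `g ∈ SL₂(F)` is `ℂ`-differentiable on `ℍ`. -/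
theorem slh_differentiableOn_moeb (g : SL(2, F)) : DifferentiableOn ℂ (moeb g) (halfSpace F) :=
  differentiableOn_pi.2 fun σ ↦ by
    simp only [moeb, div_eq_mul_inv]
    exact (slh_differentiable_num g σ).differentiableOn.mul
      ((slh_differentiable_denom g σ).differentiableOn.inv fun z hz ↦ denom_ne_zero g hz σ)

/-- Precomposition with the action of `g ∈ SL₂(F)` preserves holomorphy on `ℍ`: `z ↦ f (g z)` is
`ℂ`-differentiable on `ℍ` for `f` holomorphic on `ℍ` (chain rule; `g` maps `ℍ` into itself because
`Im (g z)_σ = Im z_σ / |σ(c) z_σ + σ(d)|² > 0`, using `σ(a) σ(d) - σ(b) σ(c) = 1`). -/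
theorem slh_differentiableOn_comp_moeb (g : SL(2, F)) {f : Point F → ℂ} (hf : IsHolomorphicOn F f) :
    DifferentiableOn ℂ (fun z ↦ f (moeb g z)) (halfSpace F) := by
  refine hf.comp (slh_differentiableOn_moeb g) fun z hz σ ↦ ?_
  -- `ℍ`-stability of the action at the embedding `σ`
  have hdet : σ (g 0 0) * σ (g 1 1) - σ (g 0 1) * σ (g 1 0) = 1 := by
    have h := Matrix.det_fin_two (g : Matrix (Fin 2) (Fin 2) F)
    rw [g.det_coe] at h
    rw [← map_mul, ← map_mul, ← map_sub, ← h, map_one]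
  have him : (moeb g z σ).im = (z σ).im / Complex.normSq (denom g z σ) := by
    simp only [moeb, denom, Complex.div_im, Complex.add_re, Complex.mul_re, Complex.ofReal_re,
      Complex.ofReal_im, Complex.add_im, Complex.mul_im, zero_mul, sub_zero, add_zero]
    rw [← sub_div]
    congr 1
    linear_combination (z σ).im * hdet
  rw [him]
  exact div_pos (hz σ) (Complex.normSq_pos.2 (denom_ne_zero g hz σ))

/-- A finite product of functions `ℂ`-differentiable on a set is `ℂ`-differentiable on it (general
normed-space domain). -/
theorem slh_differentiableOn_finset_prod {ι : Type*} (u : Finset ι) {φ : ι → Point F → ℂ}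
    {s : Set (Point F)} (h : ∀ i ∈ u, DifferentiableOn ℂ (φ i) s) :
    DifferentiableOn ℂ (fun z ↦ ∏ i ∈ u, φ i z) s := by
  classical
  intro z hz
  exact (HasFDerivWithinAt.finsetProd fun i hi ↦
    (h i hi z hz).hasFDerivWithinAt).differentiableWithinAt

/-- The automorphy factor `z ↦ J_k(g, z) = ∏_σ (σ(c) z_σ + σ(d))^{k_σ}` is `ℂ`-differentiable on `ℍ`
(integral powers of non-vanishing differentiable functions). -/
theorem slh_differentiableOn_autFactor (k : (F →+* ℝ) → ℤ) (g : SL(2, F)) :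
    DifferentiableOn ℂ (autFactor k g) (halfSpace F) := by
  have h : autFactor k g = fun z ↦ ∏ σ ∈ Finset.univ, denom g z σ ^ k σ := rfl
  rw [h]
  exact slh_differentiableOn_finset_prod Finset.univ fun σ _ ↦
    (slh_differentiable_denom g σ).differentiableOn.zpow
      (Or.inl fun z hz ↦ denom_ne_zero g hz σ)

/-- **stub M-A6 — `stub_slash_holomorphic`.** The weight-`k` slash `f|_k g : z ↦ J_k(g, z)⁻¹ f(g z)`
of a function `f` holomorphic on `ℍ` by any `g ∈ SL₂(F)` is holomorphic on `ℍ`. -/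
theorem stub_slash_holomorphic (F : Type) [Field F] [NumberField F] (k : (F →+* ℝ) → ℤ)
    (g : SL(2, F)) (f : Point F → ℂ) (hf : IsHolomorphicOn F f) :
    IsHolomorphicOn F (slash k g f) := by
  have hcomp : DifferentiableOn ℂ (fun z ↦ f (moeb g z)) (halfSpace F) :=
    slh_differentiableOn_comp_moeb g hf
  have hinv : DifferentiableOn ℂ (fun z ↦ (autFactor k g z)⁻¹) (halfSpace F) :=
    (slh_differentiableOn_autFactor k g).inv fun z hz ↦ autFactor_ne_zero k g hz
  exact hinv.mul hcomp

end Summit.Langlands.Langlands.Theorems.HilbertIntegralOverconvergentIsCongruence
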